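import Summits.KontsevichZagierPeriods.KontsevichZagierPeriods.Theorems.TerasomaMultiplicationGammaHodgeSectorTorsionKilling
import Summits.KontsevichZagierPeriods.KontsevichZagierPeriods.Theorems.TerasomaMultiplicationMultiplicationAccessible

/-!
# `GammaHodgeSector` (stmt-KontsevichZagierPeriods-3742) — line `koblitz-ogus-halving`, lead skeleton v7 (lead seat c7, 2026-08-17)

Crux `Summit.KontsevichZagierPeriods.KontsevichZagierPeriods.Theses.TerasomaMultiplication.GammaHodgeSector`
(Deligne / Koblitz–Ogus Hodge-type Beta identities inside the Kontsevich–Zagier rules).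

RESHAPE v6 → v7. Crux 3 of the route, `MultiplicationAccessible` (stmt-12305), is now a THEOREM of
the tree (`MultiplicationAccessible_of`, Theorems/TerasomaMultiplicationMultiplicationAccessible.lean,
p129167, 2026-08-16 22:26Z). The composition of the line therefore loses its last hypothesis:
`GammaHodgeSector_of : GammaHodgeSector` with NO arguments, from ONE stub.

Everything else of the line is LANDED and imported: lattice theorem (p90277, p87181, p90278), power
identity `⟦r⟧^{n₀} = ⟦r'⟧^{n₀}` in `P = FormalRep ⧸ relations` (p96715), root extraction from
cancellation and its identification with SelbergAMGM's torsion killing (p112409: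
`positiveCancellation_iff_cancellation`, `gammaHodgeSector_of_selbergPositiveCancellation`).

The ONE stub, `stub_positiveCancellation`, is item stmt-KontsevichZagierPeriods-5621 VERBATIM
(`SelbergAMGM.PositiveCancellation`): cancellation by classes of non-zero value in `P`, an injectivity
principle of Conjecture-1 strength (≥ `KZ.PiCancellation ∧ BetaCancellation`, Disproof §8
`stubPositiveRoot_sandwich`; summit-implied, so not refutable short of the summit). It is NOT claimed
provable by the means of this line.
-/

noncomputable section

open MeasureTheory Set
open scoped BigOperators

namespace Summit.KontsevichZagierPeriods.GammaHodgeSectorKO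

open Literature.NumberTheory.Transcendental
open Literature.NumberTheory.Transcendental.KZ
open Summit.KontsevichZagierPeriods.KontsevichZagierPeriods.Theses.TerasomaMultiplication
  (GammaHodgeSector MultiplicationAccessible BetaCancellation)
open Summit.KontsevichZagierPeriods.KontsevichZagierPeriods.Theses.SelbergAMGM (PositiveCancellation)
open Summit.KontsevichZagierPeriods.TerasomaMultiplication.MultiplicationAccessible (MultiplicationAccessible_of)

/-! ## The stub -/

/-- STUB (= item stmt-KontsevichZagierPeriods-5621 VERBATIM, route SelbergAMGM's crux
`PositiveCancellation`, "torsion killing"; summit-implied and NOT claimed provable here): in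
`FormalRep` with its Fubini product, `x³k − y³k ∈ relations`, `eval x > 0`, `eval y > 0`,
`eval k ≠ 0 ⇒ x − y ∈ relations`. Equivalent to cancellation by classes of non-zero value
(`positiveCancellation_iff_cancellation`). [folklore] -/
theorem stub_positiveCancellation : PositiveCancellation := by
  sorry

/-- The previously registered stub of the line, a theorem modulo `stub_positiveCancellation`:
POSITIVE ROOTS ARE UNIQUE in the formal period ring `P = FormalRep ⧸ relations`. [folklore] -/
theorem stub_positiveRoots :
    ∀ (n : ℕ) ⦃d d' : ℕ⦄ (ρ : IntegralRep d) (ρ' : IntegralRep d'), 0 < n →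
      toFormalPeriod (of ρ) ^ n = toFormalPeriod (of ρ') ^ n → 0 < ρ.value → ρ.value = ρ'.value →
      Equivalent ρ ρ' :=
  positiveRoots_of_selbergPositiveCancellation stub_positiveCancellation

/-! ## The composition (hypothesis-free since 12305 landed) -/

/-- **`GammaHodgeSector` from the line's single input**: torsion killing (`stub_positiveCancellation`
= stmt-5621) — Gauss multiplication as chains (`MultiplicationAccessible_of`, stmt-12305, PROVED),
Euler reflection at rational arguments (PROVED) and `BetaCancellation` (stmt-13633, a consequence of
stmt-5621) being discharged — through the landed lattice theorem, power identity and root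
extraction. [cite: Deligne1982HodgeCycles, Thm. 7.18] -/
theorem GammaHodgeSector_of : GammaHodgeSector :=
  gammaHodgeSector_of_selbergPositiveCancellation stub_positiveCancellation MultiplicationAccessible_of

/-- The same for the verbatim copy of the crux in route `MotivatedMoves` (the two route decls have
the same body; stmt-KontsevichZagierPeriods-3742 is shared). [cite: Deligne1982HodgeCycles, Thm. 7.18] -/
theorem GammaHodgeSector_of' :
    Summit.KontsevichZagierPeriods.KontsevichZagierPeriods.Theses.MotivatedMoves.GammaHodgeSector :=
  GammaHodgeSector_of

end Summit.KontsevichZagierPeriods.GammaHodgeSectorKO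

end
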